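import Summits.CriticalPhenomena.PercolationContinuityZ3.Theorems.Transplant.PlanarSkeletonFrm1
import HarnessLib

/-!
# Φ2 at the interface level, III: RAYS and STAIRCASES from the unit steps (ι), and the UNIFORM FIBRE-ADJUSTMENT bound from the frames

builds on p205010 (kernel theorem, internal audit signed; external expert review pending) — nothing in this file uses p205010; nothing
here is a claim about the open node `SamePDropOfSkeletonFrm₁`.
Lane `prim-bschramm`, seat `prim-bschramm-p4` gen 14 (PART C3 of `P4-GENERAL.md`, §36: Φ2 DERIVED for one-type frames-only skeletons).
Helper file (`--supports stmt-CriticalPhenomena-4575 --as helper`).  No probability.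

The enhancement run of a cycle kit (file IV) goes from the apex of the column of `x` (on the ceiling `φ₀ − φ₀ t = ℓ+2` of the big cylinder
`C_{ℓ+3}(t)`) AROUND the small cylinder `C_ℓ(t)` to the foot of the column of `y` (on the floor `φ₀ − φ₀ t = −(ℓ+2)`).  Two graph-level
devices replace the group words of the Cayley construction (`CayleyCylinderKit.frame`, gen 10):
* `exists_ray` / **`exists_stair`**: walks with EXACT `φ`-track from (ι) — along the square `‖φ − φ t‖_∞ = ℓ+2` from `(ℓ+2, m)` to
  `(−(ℓ+2), m')`, length `≤ 6ℓ+12`, every vertex outside the box `Λ_ℓ` and inside `Λ_{ℓ+2}`;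
* **`exists_adjust_bound`**: for every `D` a bound `N` such that ANY two vertices of EQUAL skeleton position at graph distance `≤ D` are
  joined by a walk of length `≤ N` inside the unit cylinder around them — cylinders are connected by (κ), the bound is uniform because a
  frame carries the pair to (base vertex, vertex of the FINITE ball of radius `D` around it) and frames map unit cylinders onto unit
  cylinders.  This is the only compactness in the construction; it is what bounds the zone radius of the kits.
[cite: KozmaNitzan2024, §4 p. 15 (boxes and their translates); p. 26 ((29))] [cite: AizenmanGrimmett1991, Thm 1 (essential enhancements)]
-/

noncomputable section

namespace Summit.CriticalPhenomena.PercolationContinuityZ3.Theorems.Transplant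

namespace PlanarSkeletonFrm

open SimpleGraph Walk Literature.Probability.LatticeModels
open Literature.Barriers.CriticalPhenomena (graphBall graphBall_finite)
open scoped Classical

variable {V : Type} {G : SimpleGraph V} [G.LocallyFinite] (Φ : PlanarSkeletonFrm G)

/-! ## §1 Rays -/

/-- **A ray of `k` unit steps** in direction `σ eᵢ` from `v`: a walk of length `k` whose `j`-th vertex sits at `φ v + jσ eᵢ`.
[cite: KozmaNitzan2024, §4 p. 26 ((29))] -/
theorem exists_ray (v : V) (i : Fin 2) (σ : ℤˣ) (k : ℕ) :
    ∃ v', ∃ W : G.Walk v v', W.length = k ∧ Φ.φ v' = Φ.φ v + Pi.single i ((k : ℤ) * σ) ∧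
      ∀ u ∈ W.support, ∃ j : ℕ, j ≤ k ∧ Φ.φ u = Φ.φ v + Pi.single i ((j : ℤ) * σ) := by
  induction k with
  | zero =>
    refine ⟨v, Walk.nil, rfl, by simp, fun u hu => ⟨0, le_rfl, ?_⟩⟩
    rw [Walk.support_nil, List.mem_singleton] at hu
    subst hu; simp
  | succ k ih =>
    obtain ⟨v', W, hlen, hφ, hsup⟩ := ih
    obtain ⟨v'', hadj, hφ''⟩ := Φ.step v' i σ
    refine ⟨v'', W.append (Walk.cons hadj Walk.nil), by rw [Walk.length_append, Walk.length_cons, Walk.length_nil, hlen], ?_, ?_⟩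
    · rw [hφ'', hφ, add_assoc, ← Pi.single_add]; push_cast; ring_nf
    · intro u hu
      rw [Walk.mem_support_append_iff, Walk.support_cons, Walk.support_nil, List.mem_cons, List.mem_singleton] at hu
      rcases hu with hu | rfl | rfl
      · obtain ⟨j, hj, hju⟩ := hsup u hu
        exact ⟨j, Nat.le_succ_of_le hj, hju⟩
      · exact ⟨k, Nat.le_succ k, hφ⟩
      · refine ⟨k + 1, le_rfl, ?_⟩
        rw [hφ'', hφ, add_assoc, ← Pi.single_add]; push_cast; ring_nf

/-- Coordinates along a ray in direction `e₁`. [folklore] -/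
theorem ray_coords_one {v u : V} {σ : ℤˣ} {j : ℕ} (h : Φ.φ u = Φ.φ v + Pi.single 1 ((j : ℤ) * σ)) :
    Φ.φ u 0 = Φ.φ v 0 ∧ Φ.φ u 1 = Φ.φ v 1 + j * σ := by
  constructor
  · rw [h, Pi.add_apply, Pi.single_eq_of_ne (by decide), add_zero]
  · rw [h, Pi.add_apply, Pi.single_eq_same]

/-- Coordinates along a ray in direction `e₀`. [folklore] -/
theorem ray_coords_zero {v u : V} {σ : ℤˣ} {j : ℕ} (h : Φ.φ u = Φ.φ v + Pi.single 0 ((j : ℤ) * σ)) :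
    Φ.φ u 0 = Φ.φ v 0 + j * σ ∧ Φ.φ u 1 = Φ.φ v 1 := by
  constructor
  · rw [h, Pi.add_apply, Pi.single_eq_same]
  · rw [h, Pi.add_apply, Pi.single_eq_of_ne (by decide), add_zero]

/-! ## §2 The staircase around the small cylinder -/

/-- **THE STAIRCASE**: from a ceiling vertex `p` (`φ₀ p − φ₀ t = ℓ+2`, `|φ₁ p − φ₁ t| ≤ ℓ+2`) along the square `‖φ − φ t‖_∞ = ℓ+2`
(up the east side, along the top, down the west side) to a floor vertex `q'` with `φ q' − φ t = (−(ℓ+2), m')`; length `≤ 6ℓ+12`; every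
vertex outside `Λ_ℓ` and inside `Λ_{ℓ+2}`. [cite: KozmaNitzan2024, §4 p. 26 ((29))] -/
theorem exists_stair (t p : V) (ℓ : ℕ) (m' : ℤ) (hp0 : Φ.φ p 0 - Φ.φ t 0 = (ℓ : ℤ) + 2)
    (hp1 : |Φ.φ p 1 - Φ.φ t 1| ≤ (ℓ : ℤ) + 2) (hm' : |m'| ≤ (ℓ : ℤ) + 2) :
    ∃ q', ∃ W : G.Walk p q', Φ.φ q' 0 - Φ.φ t 0 = -((ℓ : ℤ) + 2) ∧ Φ.φ q' 1 - Φ.φ t 1 = m' ∧ W.length ≤ 6 * ℓ + 12 ∧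
      ∀ u ∈ W.support, (|Φ.φ u 0 - Φ.φ t 0| ≤ (ℓ : ℤ) + 2 ∧ |Φ.φ u 1 - Φ.φ t 1| ≤ (ℓ : ℤ) + 2) ∧
        ((ℓ : ℤ) + 1 ≤ |Φ.φ u 0 - Φ.φ t 0| ∨ (ℓ : ℤ) + 1 ≤ |Φ.φ u 1 - Φ.φ t 1|) := by
  rw [abs_le] at hp1 hm'
  -- leg 1: east side, upwards in `e₁`
  obtain ⟨c₁, W₁, hlen₁, hφ₁, hsup₁⟩ := Φ.exists_ray p 1 1 ((ℓ : ℤ) + 2 - (Φ.φ p 1 - Φ.φ t 1)).toNat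
  have hc₁ := Φ.ray_coords_one hφ₁
  rw [Units.val_one, mul_one, Int.toNat_of_nonneg (by omega)] at hc₁
  -- leg 2: top side, downwards in `e₀`
  obtain ⟨c₂, W₂, hlen₂, hφ₂, hsup₂⟩ := Φ.exists_ray c₁ 0 (-1) (2 * ℓ + 4)
  have hc₂ := Φ.ray_coords_zero hφ₂
  rw [Units.val_neg, Units.val_one] at hc₂
  -- leg 3: west side, downwards in `e₁`
  obtain ⟨q', W₃, hlen₃, hφ₃, hsup₃⟩ := Φ.exists_ray c₂ 1 (-1) ((ℓ : ℤ) + 2 - m').toNat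
  have hc₃ := Φ.ray_coords_one hφ₃
  rw [Units.val_neg, Units.val_one, Int.toNat_of_nonneg (by omega)] at hc₃
  refine ⟨q', (W₁.append W₂).append W₃, ?_, ?_, ?_, ?_⟩
  · rw [hc₃.1, hc₂.1, hc₁.1]; push_cast; omega
  · rw [hc₃.2, hc₂.2, hc₁.2]; omega
  · rw [Walk.length_append, Walk.length_append, hlen₁, hlen₂, hlen₃]; omega
  · intro u hu
    rw [Walk.mem_support_append_iff, Walk.mem_support_append_iff] at hu
    rcases hu with (hu | hu) | hu
    · obtain ⟨j, hj, hju⟩ := hsup₁ u hu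
      have hc := Φ.ray_coords_one hju
      rw [Units.val_one, mul_one] at hc
      have hj' : (j : ℤ) ≤ (ℓ : ℤ) + 2 - (Φ.φ p 1 - Φ.φ t 1) := by
        have := (Int.toNat_of_nonneg (show (0 : ℤ) ≤ (ℓ : ℤ) + 2 - (Φ.φ p 1 - Φ.φ t 1) by omega)); omega
      refine ⟨⟨abs_le.2 ⟨by omega, by omega⟩, abs_le.2 ⟨by omega, by omega⟩⟩, Or.inl ?_⟩
      rw [hc.1, hp0, abs_of_nonneg (by omega)]; omega
    · obtain ⟨j, hj, hju⟩ := hsup₂ u hu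
      have hc := Φ.ray_coords_zero hju
      rw [Units.val_neg, Units.val_one] at hc
      have hj' : (j : ℤ) ≤ 2 * ℓ + 4 := by exact_mod_cast hj
      refine ⟨⟨abs_le.2 ⟨by omega, by omega⟩, abs_le.2 ⟨by omega, by omega⟩⟩, Or.inr ?_⟩
      rw [hc.2, hc₁.2]
      rw [abs_of_nonneg (by omega)]; omega
    · obtain ⟨j, hj, hju⟩ := hsup₃ u hu
      have hc := Φ.ray_coords_one hju
      rw [Units.val_neg, Units.val_one] at hc
      have hj' : (j : ℤ) ≤ (ℓ : ℤ) + 2 - m' := by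
        have := (Int.toNat_of_nonneg (show (0 : ℤ) ≤ (ℓ : ℤ) + 2 - m' by omega)); omega
      refine ⟨⟨abs_le.2 ⟨by omega, by omega⟩, abs_le.2 ⟨by omega, by omega⟩⟩, Or.inl ?_⟩
      rw [hc.1, hc₂.1, hc₁.1]
      rw [abs_of_nonpos (by push_cast; omega)]; push_cast; omega

/-! ## §3 The uniform fibre-adjustment bound -/

/-- Two vertices of the unit cylinder at a BASE vertex are joined inside it (field (κ) at `ℓ = 1`). [cite: KozmaNitzan2024, §4 p. 15] -/
theorem exists_walk_in_unitCyl {t' : V} (ht' : t' ∈ Φ.types) {u : V} (hu : Φ.φ u = Φ.φ t') :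
    ∃ W : G.Walk t' u, ∀ z ∈ W.support, Φ.φ z - Φ.φ t' ∈ box 2 1 := by
  have hconn := Φ.cyl_connected t' ht' 1 le_rfl
  have hmt : t' ∈ {w | Φ.φ w - Φ.φ t' ∈ box 2 1} := by
    show Φ.φ t' - Φ.φ t' ∈ box 2 1; rw [sub_self]; exact zero_mem_box 2 1
  have hmu : u ∈ {w | Φ.φ w - Φ.φ t' ∈ box 2 1} := by
    show Φ.φ u - Φ.φ t' ∈ box 2 1; rw [hu, sub_self]; exact zero_mem_box 2 1
  obtain ⟨W₀⟩ := hconn.preconnected ⟨t', hmt⟩ ⟨u, hmu⟩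
  have key : ∀ z ∈ (W₀.map (Embedding.induce {w | Φ.φ w - Φ.φ t' ∈ box 2 1}).toHom).support, Φ.φ z - Φ.φ t' ∈ box 2 1 := by
    intro z hz
    rw [Walk.support_map, List.mem_map] at hz
    obtain ⟨z₀, -, rfl⟩ := hz
    exact z₀.2
  exact ⟨_, key⟩

omit [G.LocallyFinite] in
/-- Graph balls are carried by automorphisms. [folklore] -/
theorem mem_graphBall_map (α : G ≃g G) {x y : V} {n : ℕ} (h : y ∈ graphBall G x n) : α y ∈ graphBall G (α x) n := by
  obtain ⟨w, hw⟩ := h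
  exact ⟨w.map α.toEmbedding.toHom, by rw [Walk.length_map]; exact hw⟩

/-- **THE UNIFORM FIBRE-ADJUSTMENT BOUND**: for every `D` there is `N` such that any two vertices with the SAME skeleton position at graph
distance `≤ D` are joined by a walk of length `≤ N` inside the unit cylinder around them.  (Frames reduce to the base vertices and the
finite balls around them; (κ) connects unit cylinders.) [cite: KozmaNitzan2024, §4 p. 15 (boxes and their translates)] -/
theorem exists_adjust_bound (D : ℕ) : ∃ N : ℕ, ∀ w w' : V, Φ.φ w' = Φ.φ w → w' ∈ graphBall G w D →
    ∃ W : G.Walk w w', W.length ≤ N ∧ ∀ z ∈ W.support, Φ.φ z - Φ.φ w ∈ box 2 1 := by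
  -- a connecting walk inside the unit cylinder for every (base vertex, vertex over it)
  have key : ∀ t' : V, ∀ u : V, ∃ W : G.Walk t' u, t' ∈ Φ.types → Φ.φ u = Φ.φ t' → ∀ z ∈ W.support, Φ.φ z - Φ.φ t' ∈ box 2 1 := by
    intro t' u
    by_cases h : t' ∈ Φ.types ∧ Φ.φ u = Φ.φ t'
    · obtain ⟨W, hW⟩ := Φ.exists_walk_in_unitCyl h.1 h.2
      exact ⟨W, fun _ _ => hW⟩
    · by_cases hr : G.Reachable t' u
      · obtain ⟨W⟩ := hr
        exact ⟨W, fun h1 h2 => absurd ⟨h1, h2⟩ h⟩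
      · exfalso
        exact hr ((Φ.graph_connected t').preconnected t' u)
  choose Wf hWf using key
  -- the bound: the longest chosen walk over the finitely many (base vertex, vertex of its `D`-ball over it)
  let B : V → Finset V := fun t' => (graphBall_finite G t' D).toFinset
  refine ⟨Φ.types.sup fun t' => (B t').sup fun u => (Wf t' u).length, fun w w' hφ hball => ?_⟩
  obtain ⟨t', ht', α, hαt, hα⟩ := Φ.frame w
  set u := α.symm w' with hu
  have hαu : α u = w' := by rw [hu, RelIso.apply_symm_apply]
  have hφu : Φ.φ u = Φ.φ t' := by
    have h := hα u
    rw [hαu, hφ] at h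
    linear_combination -h
  have hub : u ∈ B t' := by
    rw [Set.Finite.mem_toFinset]
    have h := mem_graphBall_map α.symm hball
    rwa [← hαt, RelIso.symm_apply_apply] at h
  refine ⟨((Wf t' u).map α.toEmbedding.toHom).copy hαt hαu, ?_, ?_⟩
  · rw [Walk.length_copy, Walk.length_map]
    exact (Finset.le_sup (f := fun u => (Wf t' u).length) hub).trans
      (Finset.le_sup (f := fun t' => (B t').sup fun u => (Wf t' u).length) ht')
  · intro z hz
    rw [Walk.support_copy, Walk.support_map, List.mem_map] at hz
    obtain ⟨z₀, hz₀, rfl⟩ := hz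
    have h := hWf t' u ht' hφu z₀ hz₀
    have e : Φ.φ ((α.toEmbedding.toHom : G →g G) z₀) - Φ.φ w = Φ.φ z₀ - Φ.φ t' := by
      show Φ.φ (α z₀) - Φ.φ w = Φ.φ z₀ - Φ.φ t'
      rw [hα z₀]; abel
    rw [e]; exact h

end PlanarSkeletonFrm

end Summit.CriticalPhenomena.PercolationContinuityZ3.Theorems.Transplant

end
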